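import Summits.ValiantsHypothesis.ValiantsHypothesis.Theorems.SymPencilPerFourOneRowProduct
import Summits.ValiantsHypothesis.ValiantsHypothesis.Theorems.SymPencilPerFourOneRowReadingPairs
import Summits.ValiantsHypothesis.ValiantsHypothesis.Theorems.SymPencilSingSixClassificationAntiBlock
import Mathlib.Data.Fintype.Perm

/-!
# Route `SymPencil` — leaf R1N of the `(11, 5, 4)` cascade: the PRODUCT branch in general position
# (`--supports` stmt-ValiantsHypothesis-5674 `SdcSuperquadratic`; memo `SING-FIVE-CLASSIFICATION.md` §6.5; closes the conjunct
# `R1NProduct K` of the residual `stub_R1N_residual` of `Cruxes/SdcSuperquadratic/Lines/sing_five_classification.lean`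
# (rev 10) — its statement below is that conjunct with `PerDirFour W` unfolded; rung currency only)

`r1nProduct`: `W ⊆ K^{4×4}` singular, `dim W = 5`, zero row `3`, no zero column, `¬ TwoZeroRows`, `¬ InCross`, a
per-direction family of `≤ 4` squares at every `y ∈ W`, a live row `r` of rank `3` whose kernel plane is the PRODUCT plane
`K(0; ℓ; 0) ⊕ K(0; 0; ℓ^σ)` (`ℓ = α e_j + β e_c`) — impossible.  Proof: transport by the row/column relabelling
`biPermL ρ γ` (`ρ = (3, r, s, t)`, `γ 0 = j`, `γ 1 = c`) to the normal position of ✓ `product_absurd` (zero row `0`,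
`r, s, t = 1, 2, 3`, `(j, c) = (0, 1)`); the pair tests (T1) at rows `(1,2)`, `(1,3)` for ALL elements come from the
three-row reading ✓ `sb₁₂`, ✓ `sb₁₃` and ✓ `sum_sq_swap_map`.

Honest framing: [folklore] transport for ONE leaf of ONE of four open size-27 cells; the TORIC conjunct `R1NToric K`, leaf
R1N and the cell file remain OPEN; `27 ≤ sdc(per₄) ≤ 29` unchanged; the crux `SdcSuperquadratic` and `VP ≠ VNP` untouched; no
summit statement is proved here.  No definitions, no named facts.
-/

noncomputable section

set_option linter.dupNamespace false

namespace Summit.ValiantsHypothesis.ValiantsHypothesis.Theorems.SymPencilPerFourOneRowProduct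

open Module MvPolynomial
open Literature.Computability.AlgebraicComplexity
open Summit.ValiantsHypothesis.ValiantsHypothesis.Theorems.SymPencilSingSixClassification
open Summit.ValiantsHypothesis.ValiantsHypothesis.Theorems.SymPencilPerFourOneRowKernelPlane
open Summit.ValiantsHypothesis.ValiantsHypothesis.Theorems.SymPencilPerFourOneRowReading
open Summit.ValiantsHypothesis.ValiantsHypothesis.Theorems.SymPencilPerFourTwoRowCorankTwo

variable {K : Type*} [Field K]

set_option synthInstance.maxSize 1024 in
/-- A permutation of `Fin 4` with `ρ = (3, r, s, t)` for distinct `r, s, t ≠ 3`. [folklore] -/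
theorem exists_perm_three_rst : ∀ r s t : Fin 4, r ≠ s → r ≠ t → s ≠ t → r ≠ 3 → s ≠ 3 → t ≠ 3 →
    ∃ ρ : Equiv.Perm (Fin 4), ρ 0 = 3 ∧ ρ 1 = r ∧ ρ 2 = s ∧ ρ 3 = t := by
  decide

/-- `lvec j c α β` relabelled by a permutation with `γ 0 = j`, `γ 1 = c` is `lvec 0 1 α β`. [folklore] -/
theorem lvec_comp_perm (γ : Equiv.Perm (Fin 4)) {j c : Fin 4} (h0 : γ 0 = j) (h1 : γ 1 = c) (α β : K) :
    (lvec j c α β) ∘ γ = lvec 0 1 α β := by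
  funext m
  have e0 : (γ m = j) ↔ (m = 0) := by rw [← h0, γ.injective.eq_iff]
  have e1 : (γ m = c) ↔ (m = 1) := by rw [← h1, γ.injective.eq_iff]
  simp only [Function.comp_apply, lvec, Pi.add_apply, Pi.smul_apply, Pi.single_apply, smul_eq_mul, mul_ite,
    mul_one, mul_zero, e0, e1]

/-- **§6.5 in general position — the conjunct `R1NProduct K` of the R1N residual.**  See the module docstring.
[folklore] -/
theorem r1nProduct [CharZero K] (W : Submodule K (Fin 4 × Fin 4 → K)) (hS : Sing3 W)
    (_h5 : finrank K W = 5) (hrow : ∀ x ∈ W, ∀ j : Fin 4, x (3, j) = 0)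
    (hncol : ¬ (∃ j : Fin 4, ∀ x ∈ W, ∀ i : Fin 4, x (i, j) = 0))
    (_hn2 : ¬ TwoZeroRows W) (hnX : ¬ InCross W)
    (hP : ∀ y ∈ W, ∃ (c : Fin 4 → K) (Λ : Fin 4 → ((Fin 4 × Fin 4 → K) →ₗ[K] K)),
      ∀ u : Fin 4 × Fin 4 → K, ∃ e₀ e₁ : K, ∀ s : K,
        eval (u + s • y) (perPoly (Fin 4) K) = e₀ + s * e₁ + s ^ 2 * ∑ k, c k * (Λ k u) ^ 2)
    (r s t : Fin 4) (hrs : r ≠ s) (hrt : r ≠ t) (hst : s ≠ t) (hr3 : r ≠ 3) (hs3 : s ≠ 3) (ht3 : t ≠ 3)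
    (hnr : finrank K (W.map (rowL (K := K) r)) = 3)
    (hprod : ∃ (j c : Fin 4) (α β : K), j ≠ c ∧ (α ≠ 0 ∨ β ≠ 0) ∧
      ∀ d, (d ∈ W ∧ row d r = 0) ↔ ((∀ i, i ≠ s → i ≠ t → row d i = 0) ∧
        (∃ μ : K, row d s = μ • lvec j c α β) ∧ (∃ ν : K, row d t = ν • lvec j c α (-β)))) : False := by
  classical
  obtain ⟨j, c, α, β, hjc, hαβ, hiff⟩ := hprod
  obtain ⟨ρ, hρ0, hρ1, hρ2, hρ3⟩ := exists_perm_three_rst r s t hrs hrt hst hr3 hs3 ht3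
  obtain ⟨γ, hγ0, hγ1⟩ := SymPencilPerFourBlocks.exists_perm_zero_one j c hjc
  set Φ : (Fin 4 × Fin 4 → K) ≃ₗ[K] (Fin 4 × Fin 4 → K) := biPermL ρ γ with hΦ_def
  have hΦa : ∀ (x : Fin 4 × Fin 4 → K) (i m : Fin 4), Φ x (i, m) = x (ρ i, γ m) := fun x i m => rfl
  have hrowΦ : ∀ (x : Fin 4 × Fin 4 → K) (i : Fin 4), row (Φ x) i = (row x (ρ i)) ∘ γ := fun x i => rfl
  have hΦper : ∀ z, eval (Φ z) (perPoly (Fin 4) K) = eval z (perPoly (Fin 4) K) := fun z => by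
    have hz : (Φ z : Fin 4 × Fin 4 → K) = z ∘ (Equiv.prodCongr ρ γ) := rfl
    rw [hz, SymPencilPerFourBlocks.eval_perPoly_comp_prodCongr]
  have comp_zero : ∀ f : Fin 4 → K, f ∘ γ = 0 ↔ f = 0 := fun f => by
    constructor
    · intro h
      funext m
      have h' := congr_fun h (γ.symm m)
      simpa using h'
    · intro h
      rw [h]
      rfl
  have comp_inj : ∀ f g : Fin 4 → K, f ∘ γ = g ∘ γ → f = g := fun f g h => by
    funext m
    have h' := congr_fun h (γ.symm m)
    simpa using h'
  set W' : Submodule K (Fin 4 × Fin 4 → K) :=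
    W.map (Φ : (Fin 4 × Fin 4 → K) →ₗ[K] (Fin 4 × Fin 4 → K)) with hW'_def
  have hmemW' : ∀ x, Φ x ∈ W' ↔ x ∈ W := fun x => by
    constructor
    · intro hx
      obtain ⟨x', hx', hxe⟩ := Submodule.mem_map.1 hx
      rwa [← Φ.injective hxe]
    · exact fun hx => Submodule.mem_map_of_mem hx
  -- the hypotheses of `product_absurd` for `W'`
  have hS' : Sing3 W' := sing3_map_biPermL hS ρ γ
  have hi' : ∀ y ∈ W', row y 0 = 0 := by
    rintro _ ⟨x, hx, rfl⟩
    funext m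
    show x (ρ 0, γ m) = 0
    rw [hρ0]
    exact hrow x hx (γ m)
  have hcol' : ∀ m : Fin 4, ∃ y ∈ W', ∃ i : Fin 4, y (i, m) ≠ 0 := by
    intro m
    by_contra hne
    push Not at hne
    refine hncol ⟨γ m, fun x hx i => ?_⟩
    have h : x (ρ (ρ.symm i), γ m) = 0 := hne (Φ x) (Submodule.mem_map_of_mem hx) (ρ.symm i)
    rwa [Equiv.apply_symm_apply] at h
  have hX' : ¬ InCross W' := by
    rintro ⟨l, c', hW⟩
    refine hnX ⟨ρ l, γ c', fun x hx i m hil hmc => ?_⟩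
    have h : x (ρ (ρ.symm i), γ (γ.symm m)) = 0 :=
      hW (Φ x) (Submodule.mem_map_of_mem hx) (ρ.symm i) (γ.symm m)
        (fun he => hil (by rw [← he, Equiv.apply_symm_apply]))
        (fun he => hmc (by rw [← he, Equiv.apply_symm_apply]))
    rwa [Equiv.apply_symm_apply, Equiv.apply_symm_apply] at h
  have hnr' : finrank K (W'.map (rowL (K := K) 1)) = 3 := by
    let vγ : (Fin 4 → K) ≃ₗ[K] (Fin 4 → K) := LinearEquiv.funCongrLeft K K γ
    have hmap : W'.map (rowL (K := K) 1) =
        (W.map (rowL (K := K) r)).map (vγ : (Fin 4 → K) →ₗ[K] (Fin 4 → K)) := by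
      rw [hW'_def, ← Submodule.map_comp, ← Submodule.map_comp]
      congr 1
      apply LinearMap.ext
      intro x
      funext m
      show x (ρ 1, γ m) = x (r, γ m)
      rw [hρ1]
    rw [hmap, LinearEquiv.finrank_map_eq, hnr]
  have hfam : ∀ y ∈ W', ∃ (c : Fin 4 → K) (Λ : Fin 4 → ((Fin 4 × Fin 4 → K) →ₗ[K] K)),
      ∀ u : Fin 4 × Fin 4 → K, ∃ e₀ e₁ : K, ∀ s : K,
        eval (u + s • y) (perPoly (Fin 4) K) = e₀ + s * e₁ + s ^ 2 * ∑ k, c k * (Λ k u) ^ 2 := by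
    rintro _ ⟨x, hx, rfl⟩
    obtain ⟨c₀, Λ, h⟩ := hP x hx
    exact ⟨c₀, fun k => (Λ k).comp Φ.symm.toLinearMap, sum_sq_swap_map Φ hΦper x c₀ Λ h⟩
  have h0' : ∀ y ∈ W', ∀ m, y (0, m) = 0 := fun y hy m => congr_fun (hi' y hy) m
  have hT12 := fun y (hy : y ∈ W') =>
    sb₁₂ (ι := Fin 4) (by simp) y (h0' y hy) (Classical.choose (hfam y hy))
      (Classical.choose (Classical.choose_spec (hfam y hy)))
      (Classical.choose_spec (Classical.choose_spec (hfam y hy)))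
  have hT13 := fun y (hy : y ∈ W') =>
    sb₁₃ (ι := Fin 4) (by simp) y (h0' y hy) (Classical.choose (hfam y hy))
      (Classical.choose (Classical.choose_spec (hfam y hy)))
      (Classical.choose_spec (Classical.choose_spec (hfam y hy)))
  have hprod' : ∀ d, d ∈ W' ⊓ LinearMap.ker (rowL 1) ↔ ((∀ x, x ≠ 2 → x ≠ 3 → row d x = 0) ∧
      (∃ μ : K, row d 2 = μ • lvec 0 1 α β) ∧ (∃ ν : K, row d 3 = ν • lvec 0 1 α (-β))) := by
    intro d'
    obtain ⟨d, rfl⟩ : ∃ d, d' = Φ d := ⟨Φ.symm d', (Φ.apply_symm_apply d').symm⟩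
    rw [Submodule.mem_inf, LinearMap.mem_ker, rowL_apply]
    have e1 : (Φ d ∈ W' ∧ row (Φ d) 1 = 0) ↔ (d ∈ W ∧ row d r = 0) := by
      rw [hmemW', hrowΦ, hρ1, comp_zero]
    have step := e1.trans (hiff d)
    refine step.trans ⟨?_, ?_⟩
    · rintro ⟨hz, ⟨μ, hμ⟩, ⟨ν, hν⟩⟩
      refine ⟨fun x hx2 hx3 => ?_, ⟨μ, ?_⟩, ⟨ν, ?_⟩⟩
      · rw [hrowΦ, comp_zero]
        refine hz (ρ x) (fun he => hx2 ?_) (fun he => hx3 ?_)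
        · exact ρ.injective (he.trans hρ2.symm)
        · exact ρ.injective (he.trans hρ3.symm)
      · rw [hrowΦ, hρ2, hμ]
        show (fun m => (μ • lvec j c α β) (γ m)) = μ • lvec 0 1 α β
        rw [← lvec_comp_perm γ hγ0 hγ1 α β]
        rfl
      · rw [hrowΦ, hρ3, hν]
        show (fun m => (ν • lvec j c α (-β)) (γ m)) = ν • lvec 0 1 α (-β)
        rw [← lvec_comp_perm γ hγ0 hγ1 α (-β)]
        rfl
    · rintro ⟨hz, ⟨μ, hμ⟩, ⟨ν, hν⟩⟩
      refine ⟨fun i his hit => ?_, ⟨μ, ?_⟩, ⟨ν, ?_⟩⟩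
      · have h := hz (ρ.symm i) (fun he => his (by rw [← hρ2, ← he, Equiv.apply_symm_apply]))
          (fun he => hit (by rw [← hρ3, ← he, Equiv.apply_symm_apply]))
        rw [hrowΦ, Equiv.apply_symm_apply, comp_zero] at h
        exact h
      · rw [hrowΦ, hρ2] at hμ
        apply comp_inj
        rw [hμ]
        show μ • lvec 0 1 α β = fun m => (μ • lvec j c α β) (γ m)
        rw [← lvec_comp_perm γ hγ0 hγ1 α β]
        rfl
      · rw [hrowΦ, hρ3] at hν
        apply comp_inj
        rw [hν]
        show ν • lvec 0 1 α (-β) = fun m => (ν • lvec j c α (-β)) (γ m)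
        rw [← lvec_comp_perm γ hγ0 hγ1 α (-β)]
        rfl
  exact product_absurd hS' hi' hcol' hX' hnr' hT12 hT13 hαβ hprod'

end Summit.ValiantsHypothesis.ValiantsHypothesis.Theorems.SymPencilPerFourOneRowProduct
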